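import Mathlib.NumberTheory.NumberField.Basic
import Mathlib.NumberTheory.RamificationInertia.Basic
import Mathlib.NumberTheory.RamificationInertia.Valuation
import Mathlib.RingTheory.DedekindDomain.Factorization
import HarnessLib

/-!
# An element that becomes a square in an odd-degree extension generates a square ideal

Topic `NumberTheory/NumberFields`, namespace `Literature.NumberTheory.NumberFields`.  Theorems only.

Let `L/K` be an extension of number fields of **odd** degree and `a ∈ 𝓞_K`, `a ≠ 0`, with
`a = g²` for some `g ∈ 𝓞_L`.  Then the principal ideal `(a)` of `𝓞_K` is the square of an ideal
of `𝓞_K` (`exists_span_eq_sq_of_odd_finrank`).  Proof: for a prime `𝔭` of `𝓞_K` the fundamental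
identity `Σ_{𝔓 ∣ 𝔭} e(𝔓|𝔭) f(𝔓|𝔭) = [L : K]` (Neukirch I (8.2); Mathlib's
`Ideal.sum_ramification_inertia`) provides a prime `𝔓 ∣ 𝔭` of odd ramification index `e`; then
`e · v_𝔭(a) = v_𝔓(a) = 2 v_𝔓(g)` (Mathlib's `intValuation_liesOver`) is even, so `v_𝔭(a)` is even,
and `(a) = ∏ 𝔭^{v_𝔭(a)} = (∏ 𝔭^{v_𝔭(a)/2})²`.

This is the ideal-theoretic device by which the tree obtains "`(j(τ) − 1728)` is a square in
`𝓞_{H_K}`" for `d_K ≡ 5 (mod 8)` from Weber's `γ₃(τ₀) = √(j(τ₀) − 1728)` lying in an extension of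
`H_K` of degree `1` or `3` (`SingularModuliWeberSquareRootInert.lean`).

## References

* J. Neukirch, *Algebraic Number Theory*, 1999, Ch. I §8, Prop. 8.2 (`Σ eᵢfᵢ = n`), §3 (prime
  factorisation of ideals). [NeukirchANT1999]
-/

noncomputable section

open NumberField IsDedekindDomain IsDedekindDomain.HeightOneSpectrum Ideal UniqueFactorizationMonoid

namespace Literature.NumberTheory.NumberFields

universe u v

variable {K : Type u} {L : Type v} [Field K] [NumberField K] [Field L] [NumberField L] [Algebra K L]

/-- **Odd degree ⇒ a prime of odd ramification index over every prime.**  For an extension `L/K`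
of number fields of odd degree and a non-zero prime `𝔭` of `𝓞_K` there is a prime `𝔓` of `𝓞_L`
over `𝔭` with `e(𝔓|𝔭)` odd (fundamental identity `Σ e f = [L : K]`). [cite: NeukirchANT1999, Ch. I Prop. 8.2] -/
theorem exists_liesOver_odd_ramificationIdx (hodd : Odd (Module.finrank K L))
    (v : HeightOneSpectrum (𝓞 K)) :
    ∃ w : HeightOneSpectrum (𝓞 L), w.asIdeal.LiesOver v.asIdeal ∧
      Odd (v.asIdeal.ramificationIdx' w.asIdeal) := by
  haveI := v.isMaximal
  have hsum := Ideal.sum_ramification_inertia (R := 𝓞 K) (S := 𝓞 L) K L v.ne_bot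
  -- not all `e·f` are even
  have hex : ∃ P ∈ IsDedekindDomain.primesOverFinset v.asIdeal (𝓞 L),
      Odd (v.asIdeal.ramificationIdx' P * v.asIdeal.inertiaDeg' P) := by
    by_contra h
    have heven : Even (∑ P ∈ IsDedekindDomain.primesOverFinset v.asIdeal (𝓞 L),
        v.asIdeal.ramificationIdx' P * v.asIdeal.inertiaDeg' P) :=
      Finset.even_sum _ fun P hP ↦ by
        rcases Nat.even_or_odd (v.asIdeal.ramificationIdx' P * v.asIdeal.inertiaDeg' P) with h1 | h1
        · exact h1
        · exact absurd ⟨P, hP, h1⟩ h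
    rw [hsum] at heven
    exact (Nat.not_even_iff_odd.mpr hodd) heven
  obtain ⟨P, hP, hPodd⟩ := hex
  obtain ⟨hPprime, hPover⟩ := (IsDedekindDomain.mem_primesOverFinset_iff v.ne_bot (𝓞 L)).mp hP
  have hP0 : P ≠ ⊥ := by
    have h := (prime_of_factor P (Multiset.mem_toFinset.mp hP)).ne_zero
    rwa [Ne, Ideal.zero_eq_bot] at h
  exact ⟨⟨P, hPprime, hP0⟩, hPover, (Nat.odd_mul.mp hPodd).1⟩

/-- **Even valuations.**  If `[L : K]` is odd and `a = g²` in `𝓞_L` (`a ∈ 𝓞_K`, `a ≠ 0`) then every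
prime of `𝓞_K` occurs in `(a)` with even multiplicity: `e · v_𝔭(a) = 2 v_𝔓(g)` with `e` odd.
[cite: NeukirchANT1999, Ch. I Prop. 8.2] -/
theorem even_count_of_sq_of_odd_finrank (hodd : Odd (Module.finrank K L)) {a : 𝓞 K} (ha : a ≠ 0)
    {g : 𝓞 L} (hg : algebraMap (𝓞 K) (𝓞 L) a = g ^ 2) (v : HeightOneSpectrum (𝓞 K)) :
    Even ((Associates.mk v.asIdeal).count (Associates.mk (Ideal.span {a})).factors) := by
  obtain ⟨w, hw, hodd_e⟩ := exists_liesOver_odd_ramificationIdx (K := K) (L := L) hodd v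
  haveI := hw
  have hg0 : g ≠ 0 := by
    intro h0
    rw [h0, zero_pow two_ne_zero, map_eq_zero_iff _ (FaithfulSMul.algebraMap_injective _ _)] at hg
    exact ha hg
  set n : ℕ := (Associates.mk v.asIdeal).count (Associates.mk (Ideal.span {a})).factors with hn
  set m : ℕ := (Associates.mk w.asIdeal).count (Associates.mk (Ideal.span {g})).factors with hm
  set e : ℕ := v.asIdeal.ramificationIdx' w.asIdeal with he
  have hval := IsDedekindDomain.HeightOneSpectrum.intValuation_liesOver v w a
  -- `v(r) = exp(−n_v(r))` for `r ≠ 0` is Mathlib's `HeightOneSpectrum.intValuation_if_neg`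
  rw [hg, map_pow, v.intValuation_if_neg ha, w.intValuation_if_neg hg0,
    ← WithZero.exp_nsmul, ← WithZero.exp_nsmul, WithZero.exp_inj] at hval
  -- `e • (−n) = 2 • (−m)` in `ℤ`
  have hnat : e * n = 2 * m := by
    have h : ((e * n : ℕ) : ℤ) = ((2 * m : ℕ) : ℤ) := by
      rw [nsmul_eq_mul, nsmul_eq_mul] at hval
      push_cast at hval ⊢
      linarith
    exact_mod_cast h
  have heven : Even (e * n) := ⟨m, by rw [hnat]; ring⟩
  exact (Nat.even_mul.mp heven).resolve_left (Nat.not_even_iff_odd.mpr hodd_e)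

/-- **A non-zero ideal all of whose prime exponents are even is a square** (in a Dedekind domain).
[folklore] -/
theorem exists_eq_sq_of_even_count {R : Type*} [CommRing R] [IsDedekindDomain R] {I : Ideal R}
    (hI : I ≠ ⊥)
    (heven : ∀ v : HeightOneSpectrum R,
      Even ((Associates.mk v.asIdeal).count (Associates.mk I).factors)) :
    ∃ 𝔟 : Ideal R, I = 𝔟 ^ 2 := by
  classical
  set c : HeightOneSpectrum R → ℕ := fun v ↦
    (Associates.mk v.asIdeal).count (Associates.mk I).factors with hc
  refine ⟨∏ᶠ v : HeightOneSpectrum R, v.asIdeal ^ (c v / 2), ?_⟩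
  have hfin : Function.HasFiniteMulSupport fun v : HeightOneSpectrum R ↦ v.asIdeal ^ (c v / 2) := by
    refine (Ideal.hasFiniteMulSupport hI).subset fun v hv ↦ ?_
    simp only [Function.mem_mulSupport] at hv ⊢
    intro h1
    apply hv
    have h0 : c v = 0 := by
      by_contra hne
      have hle : v.maxPowDividing I ≤ v.asIdeal := Ideal.pow_le_self hne
      rw [h1, Ideal.one_eq_top, top_le_iff] at hle
      exact v.isPrime.ne_top hle
    rw [h0]
    simp
  rw [finprod_pow hfin]
  conv_lhs => rw [← Ideal.finprod_heightOneSpectrum_factorization hI]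
  refine finprod_congr fun v ↦ ?_
  change v.asIdeal ^ c v = (v.asIdeal ^ (c v / 2)) ^ 2
  rw [← pow_mul]
  congr 1
  obtain ⟨k, hk⟩ := heven v
  change c v = k + k at hk
  omega

/-- **If `a ∈ 𝓞_K` becomes a square in an odd-degree extension `L/K` then `(a)` is the square of an
ideal of `𝓞_K`.** [cite: NeukirchANT1999, Ch. I Prop. 8.2 (Σ eᵢ fᵢ = n) and §3] -/
theorem exists_span_eq_sq_of_odd_finrank (hodd : Odd (Module.finrank K L)) {a : 𝓞 K} (ha : a ≠ 0)
    {g : 𝓞 L} (hg : algebraMap (𝓞 K) (𝓞 L) a = g ^ 2) :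
    ∃ 𝔟 : Ideal (𝓞 K), Ideal.span {a} = 𝔟 ^ 2 :=
  exists_eq_sq_of_even_count (by simpa using ha) (even_count_of_sq_of_odd_finrank hodd ha hg)

end Literature.NumberTheory.NumberFields

end
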